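import Summits.RiemannHypothesis.RiemannHypothesis.Theorems.JensenLogBandArcDescentIntegral
import Mathlib.MeasureTheory.Integral.IntervalIntegral.FundThmCalculus
import Mathlib.Analysis.Calculus.MeanValue
import HarnessLib

/-!
# The `ζ`-free arc integrand as an exponential of the integrated log-derivative (BAND line, S4b-0)

RH ladder column JENSEN, rung J-P(P3) «log band», BAND crux `XiDerivBandRealAllRates` of route
«JensenLogBand», line «band-one-window» (u-arc reshape), lead rh-jensen-prover g7 — scaffolding
for step (S4b) «local cubic» / (S5) «window» of HOME/rh-jensen-prover/g7-work/LINE-PLAN.md §8.2.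
RH-FREE. WHAT THIS IS NOT: calculus on an explicit integrand; nothing here bears on zeros of `ζ`
or the truth of RH.

The COMPLEX companion of eng-2 g5's `log_norm_arcModelIntegrand_sub_eq_integral` (p487630): along
an admissible arc,

  `arcModelIntegrand n h c φ = arcModelIntegrand n h c φ₀ · exp( ∫_{φ₀}^{φ} i(u(t)−c)·S_{n,c}(u(t)) dt )`

(`arcModelIntegrand_eq_mul_cexp_integral`): the Laplace window lemma `laplace_window_core`
consumes the integrand in exactly this form `I(φ₀)·cexp(−wψ² + E(ψ))`, with
`∫₀^ψ q = −wψ² + E(ψ)`, `q(φ₀) = 0` at the saddle and `q′(φ₀) = −2w = −S′(u*)(u*−c)²`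
(`arcSaddle_curvature_bound`).
-/

noncomputable section

-- single-problem summit: `Summit.RiemannHypothesis.RiemannHypothesis.…` is the tree convention
set_option linter.dupNamespace false

open Complex Real Set MeasureTheory intervalIntegral

namespace Summit.RiemannHypothesis.RiemannHypothesis.Theorems.JensenPolynomials.LogBandArc

open Literature.NumberTheory.LFunctions

/-- The admissible set of angles `{t : Re(½+u(t)) > 0, ½+u(t) ≠ 1, u(t) ≠ 0, u(t)+c ≠ 0}`
(`u(t) = c + h e^{it}`) is open. [folklore] -/
theorem isOpen_arcAdmissible (h : ℝ) (c : ℂ) :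
    IsOpen {t : ℝ | 0 < (1 / 2 + circleMap c h t).re ∧ 1 / 2 + circleMap c h t ≠ 1 ∧
      circleMap c h t ≠ 0 ∧ circleMap c h t + c ≠ 0} := by
  have hc : Continuous (circleMap c h) := continuous_circleMap c h
  have h1 : Continuous fun t : ℝ => (1 / 2 + circleMap c h t) := continuous_const.add hc
  have e : {t : ℝ | 0 < (1 / 2 + circleMap c h t).re ∧ 1 / 2 + circleMap c h t ≠ 1 ∧
      circleMap c h t ≠ 0 ∧ circleMap c h t + c ≠ 0} =
      {t : ℝ | 0 < (1 / 2 + circleMap c h t).re} ∩ {t : ℝ | 1 / 2 + circleMap c h t ≠ 1} ∩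
        {t : ℝ | circleMap c h t ≠ 0} ∩ {t : ℝ | circleMap c h t + c ≠ 0} := by
    ext t; simp [and_assoc]
  rw [e]
  refine ((IsOpen.inter ?_ ?_).inter ?_).inter ?_
  · exact isOpen_lt continuous_const (Complex.continuous_re.comp h1)
  · exact isOpen_ne_fun h1 continuous_const
  · exact isOpen_ne_fun hc continuous_const
  · exact isOpen_ne_fun (hc.add continuous_const) continuous_const

/-- **Exponential representation along an admissible arc:**
`I(φ) = I(φ₀) · exp(∫_{φ₀}^{φ} i(u(t)−c)·S_{n,c}(u(t)) dt)`. [folklore] -/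
theorem arcModelIntegrand_eq_mul_cexp_integral (n : ℕ) {h : ℝ} (hh : h ≠ 0) (c : ℂ) {φ₀ φ : ℝ}
    (hgood : ∀ t ∈ uIcc φ₀ φ, 0 < (1 / 2 + circleMap c h t).re ∧ 1 / 2 + circleMap c h t ≠ 1 ∧
      circleMap c h t ≠ 0 ∧ circleMap c h t + c ≠ 0) :
    arcModelIntegrand n h c φ = arcModelIntegrand n h c φ₀ *
      Complex.exp (∫ t in φ₀..φ, I * (circleMap c h t - c) * arcSaddleFn n c (circleMap c h t)) := by
  set q : ℝ → ℂ := fun t => I * (circleMap c h t - c) * arcSaddleFn n c (circleMap c h t) with hq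
  set U : Set ℝ := {t : ℝ | 0 < (1 / 2 + circleMap c h t).re ∧ 1 / 2 + circleMap c h t ≠ 1 ∧
      circleMap c h t ≠ 0 ∧ circleMap c h t + c ≠ 0} with hU
  have hUopen : IsOpen U := isOpen_arcAdmissible h c
  have hsub : uIcc φ₀ φ ⊆ U := fun t ht => hgood t ht
  -- `q` is continuous at every admissible angle
  have hqcont : ∀ t ∈ U, ContinuousAt q t := by
    intro t ht
    obtain ⟨hre, h1, hu0, hupc⟩ := ht
    have huc : circleMap c h t - c ≠ 0 := sub_ne_zero.2 (circleMap_ne_center hh)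
    have hcm : ContinuousAt (circleMap c h) t := (continuous_circleMap c h).continuousAt
    have hS : ContinuousAt (fun s : ℝ => arcSaddleFn n c (circleMap c h s)) t :=
      (continuousAt_arcSaddleFn n c hre h1 hu0 huc hupc).comp hcm
    exact (continuousAt_const.mul (hcm.sub continuousAt_const)).mul hS
  have hqcontOn : ContinuousOn q (uIcc φ₀ φ) := fun t ht => (hqcont t (hsub ht)).continuousWithinAt
  -- the primitive `Q(θ) = ∫_{φ₀}^{θ} q` and its derivative on the interval
  set a := min φ₀ φ with ha
  set b := max φ₀ φ with hb
  have hab : uIcc φ₀ φ = Icc a b := rfl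
  have hφ₀mem : φ₀ ∈ Icc a b := by rw [← hab]; exact left_mem_uIcc
  have hφmem : φ ∈ Icc a b := by rw [← hab]; exact right_mem_uIcc
  have hQderiv : ∀ θ ∈ Icc a b, HasDerivAt (fun s => ∫ t in φ₀..s, q t) (q θ) θ := by
    intro θ hθ
    have hθU : θ ∈ U := hsub (by rw [hab]; exact hθ)
    have hint : IntervalIntegrable q volume φ₀ θ := by
      refine (hqcontOn.mono ?_).intervalIntegrable
      rw [hab]; exact uIcc_subset_Icc hφ₀mem hθ
    exact intervalIntegral.integral_hasDerivAt_right hint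
      (ContinuousAt.stronglyMeasurableAtFilter hUopen hqcont θ hθU) (hqcont θ hθU)
  -- `G(θ) = I(θ) · exp(−Q(θ))` has zero derivative on `[a, b]`
  set G : ℝ → ℂ := fun s => arcModelIntegrand n h c s * Complex.exp (-(∫ t in φ₀..s, q t)) with hG
  have hGderiv : ∀ θ ∈ Icc a b, HasDerivAt G 0 θ := by
    intro θ hθ
    obtain ⟨hre, h1, hu0, hupc⟩ := hsub (show θ ∈ uIcc φ₀ φ by rw [hab]; exact hθ)
    have hI := hasDerivAt_arcModelIntegrand_angle n hh c θ hre h1 hu0 hupc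
    have hE : HasDerivAt (fun s => Complex.exp (-(∫ t in φ₀..s, q t)))
        (Complex.exp (-(∫ t in φ₀..θ, q t)) * (-(q θ))) θ := (hQderiv θ hθ).neg.cexp
    have := hI.mul hE
    refine this.congr_deriv ?_
    rw [hq]
    ring
  have hGcont : ContinuousOn G (Icc a b) := fun θ hθ => (hGderiv θ hθ).continuousAt.continuousWithinAt
  have hconst := constant_of_has_deriv_right_zero hGcont
    (fun θ hθ => ((hGderiv θ (Ico_subset_Icc_self hθ)).hasDerivWithinAt))
  have hGφ : G φ = G φ₀ := by rw [hconst φ hφmem, hconst φ₀ hφ₀mem]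
  -- unfold: `I(φ) e^{−Q(φ)} = I(φ₀)`
  have hQ0 : (∫ t in φ₀..φ₀, q t) = 0 := intervalIntegral.integral_same
  simp only [hG, hQ0, neg_zero, Complex.exp_zero, mul_one] at hGφ
  calc arcModelIntegrand n h c φ
      = arcModelIntegrand n h c φ * Complex.exp (-(∫ t in φ₀..φ, q t)) *
          Complex.exp (∫ t in φ₀..φ, q t) := by
        rw [mul_assoc, ← Complex.exp_add, neg_add_cancel, Complex.exp_zero, mul_one]
    _ = arcModelIntegrand n h c φ₀ * Complex.exp (∫ t in φ₀..φ, q t) := by rw [hGφ]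

end Summit.RiemannHypothesis.RiemannHypothesis.Theorems.JensenPolynomials.LogBandArc

end
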